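import Mathlib
import Summits.KontsevichZagierPeriods.Zeta5Search.Families.CoeffAsympMinimizer
import Summits.KontsevichZagierPeriods.Zeta5Search.Families.CoeffAsympLower
import HarnessLib

/-!
# ζ(5) search — Families: coefficient asymptotics of powers of a positive polynomial, VII — THE LIMIT
# `(1/n) log [x^{nB}] Pⁿ → log min (tilt on the face)`

HONEST FRAMING: systematic search; no irrationality claim unless certified.  Cell `pub-zeta5`, certifier 2
(cert-2 g9, 2026-08-22).  Elementary real analysis (method of types); no conjecture node is used; nothing about
`ζ(5)`; no number of record moves.

For `P = poly S c` with `c > 0` on the finite set of monomials `S` and a base exponent `B ∈ S`: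
* `exists_tilt_face_min` — the tilt `Σ_{α ∈ face S B} c_α e^{(α−B)·u}` attains its minimum at some `u₀`
  (`Families/CoeffAsympMinimizer` + the positive relation of `Families/CoeffAsympFace`);
* `log_coeff_div_le` — `(1/n) log [x^{nB}] Pⁿ ≤ log tilt(u₀)` for every `n ≥ 1` (tilting upper bound on the face);
* `eventually_ge_of_min` — for every `η > 0`, eventually `(1/n) log [x^{nB}] Pⁿ ≥ log tilt(u₀) − η`: the tilted measure
  at `u₀` has mean `B` and entropy functional `log tilt(u₀)`; RATIONAL measures of mean exactly `B` nearby
  (`Families/CoeffAsympRational`) give integer types and the lower bound of `Families/CoeffAsympLower`;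
* **`tendsto_log_coeff_div`** — hence `(1/n) log [x^{nB}] Pⁿ → log tilt(u₀) = log min_u tilt_{face}(u)`.
The identification of this minimum with `inf_u Σ_{α ∈ S} c_α e^{(α−B)·u}` (the infimum of the FULL Laurent polynomial
`P(x)/x^B` over the positive orthant) is the subject of the next file.  Standard axioms only.
-/

noncomputable section

open MvPolynomial Finset Real Filter Topology

namespace Summit.KontsevichZagierPeriods.Zeta5Search.Families.Cellular

namespace CoeffAsymp

variable {d : ℕ}

/-- **The tilt on the face attains its minimum.** -/
theorem exists_tilt_face_min {S : Finset (Fin d →₀ ℕ)} {c : (Fin d →₀ ℕ) → ℝ} (hc : ∀ α ∈ S, 0 < c α)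
    {B : Fin d →₀ ℕ} (hB : B ∈ S) :
    ∃ u₀ : Fin d → ℝ, ∀ u, tilt (face S B) c B u₀ ≤ tilt (face S B) c B u := by
  obtain ⟨μ, hpos, hrel⟩ := exists_pos_relation_face S B
  exact exists_isMinOn_tilt (fun α hα => hc α (face_subset S B hα)) ⟨B, self_mem_face hB⟩ hpos hrel

/-- The diagonal coefficients are positive: `[x^{nB}] Pⁿ ≥ c_B^n > 0`. -/
theorem coeff_pow_pos {S : Finset (Fin d →₀ ℕ)} {c : (Fin d →₀ ℕ) → ℝ} (hc : ∀ α ∈ S, 0 < c α)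
    {B : Fin d →₀ ℕ} (hB : B ∈ S) (n : ℕ) : 0 < coeff (n • B) (poly S c ^ n) := by
  classical
  -- the trivial type `n δ_B`
  set k : (Fin d →₀ ℕ) → ℕ := fun α => if α = B then n else 0 with hk
  have hkmem : k ∈ S.piAntidiag n := by
    rw [Finset.mem_piAntidiag]
    refine ⟨by simp [hk, hB], fun α hα => ?_⟩
    by_contra hαS
    have : α ≠ B := fun h => hαS (h ▸ hB)
    simp [hk, this] at hα
  have hkexp : typeExp S k = n • B := by
    unfold typeExp
    simp [hk, hB, ite_smul]
  have h1 := typeWeight_le_coeff (fun α hα => (hc α hα).le) hkmem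
  rw [hkexp] at h1
  refine lt_of_lt_of_le ?_ h1
  exact mul_pos (by exact_mod_cast Nat.multinomial_pos S k) (Finset.prod_pos fun α hα => pow_pos (hc α hα) _)

/-- **Upper bound**: `(1/n) log [x^{nB}] Pⁿ ≤ log tilt_{face}(u)` for every `u` and every `n ≥ 1`. -/
theorem log_coeff_div_le {S : Finset (Fin d →₀ ℕ)} {c : (Fin d →₀ ℕ) → ℝ} (hc : ∀ α ∈ S, 0 < c α)
    {B : Fin d →₀ ℕ} (hB : B ∈ S) (u : Fin d → ℝ) {n : ℕ} (hn : n ≠ 0) :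
    Real.log (coeff (n • B) (poly S c ^ n)) / n ≤ Real.log (tilt (face S B) c B u) := by
  have hn' : (0 : ℝ) < n := by exact_mod_cast Nat.pos_of_ne_zero hn
  have hT : 0 < tilt (face S B) c B u :=
    tilt_pos (fun α hα => hc α (face_subset S B hα)) ⟨B, self_mem_face hB⟩ B u
  rw [div_le_iff₀ hn', mul_comm, ← Real.log_pow]
  exact Real.log_le_log (coeff_pow_pos hc hB n) (coeff_pow_le_tilt_face_pow (fun α hα => (hc α hα).le) n B u)

/-- **Lower bound**: at a minimum `u₀` of the tilt on the face, for every `η > 0`, eventually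
`log tilt(u₀) − η ≤ (1/n) log [x^{nB}] Pⁿ`. -/
theorem eventually_ge_of_min {S : Finset (Fin d →₀ ℕ)} {c : (Fin d →₀ ℕ) → ℝ} (hc : ∀ α ∈ S, 0 < c α)
    {B : Fin d →₀ ℕ} (hB : B ∈ S) {u₀ : Fin d → ℝ} (hmin : ∀ u, tilt (face S B) c B u₀ ≤ tilt (face S B) c B u)
    {η : ℝ} (hη : 0 < η) :
    ∀ᶠ n : ℕ in atTop, Real.log (tilt (face S B) c B u₀) - η ≤ Real.log (coeff (n • B) (poly S c ^ n)) / n := by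
  classical
  set F := face S B with hF_def
  have hFS : F ⊆ S := face_subset S B
  have hcF : ∀ α ∈ F, 0 < c α := fun α hα => hc α (hFS hα)
  have hBF : B ∈ F := self_mem_face hB
  have hne : F.Nonempty := ⟨B, hBF⟩
  -- the tilted measure `μ*` at the minimum: positive on `F`, total mass `1`, mean `B`, entropy `log tilt(u₀)`
  set μ := tilted F c B u₀ with hμ_def
  have hμpos : ∀ α ∈ F, 0 < μ α := fun α hα => tilted_pos hcF hne B u₀ hα
  have hμsum : ∑ α ∈ F, μ α = 1 := sum_tilted hcF hne B u₀
  have hμmean : ∀ i, ∑ α ∈ F, μ α * dvec B α i = 0 := fun i => sum_tilted_mul_dvec hcF hne hmin i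
  have hμent : entropyFun F c μ = Real.log (tilt F c B u₀) := entropy_tilted_eq_log_tilt hcF hne hmin
  -- a uniform `ε` for the error `η/2` of the entropy functional, below `min μ`
  obtain ⟨ε₁, hε₁, hnear⟩ := entropyFun_near F c μ (half_pos hη)
  obtain ⟨αm, hαm, hmineq⟩ := Finset.exists_mem_eq_inf' hne μ
  set ε : ℝ := min ε₁ (F.inf' hne μ) with hε_def
  have hεpos : 0 < ε := lt_min hε₁ (by rw [hmineq]; exact hμpos αm hαm)
  have hεμ : ∀ α ∈ F, ε ≤ μ α := fun α hα => le_trans (min_le_right _ _) (Finset.inf'_le μ hα)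
  -- the homogeneous integer system on `ι = F`: total mass and the `d` mean equations, solved by `x = μ − δ_B`
  set δB : (Fin d →₀ ℕ) → ℝ := fun α => if α = B then 1 else 0 with hδB
  set x : F → ℝ := fun a => μ a.1 - δB a.1 with hx
  set L : List (F → ℤ) := (fun _ => (1 : ℤ)) :: List.ofFn fun i : Fin d => fun a : F => ((a.1 i : ℕ) : ℤ) - ((B i : ℕ) : ℤ)
    with hL
  have hδsum : ∑ a : F, δB a.1 = 1 := by
    rw [Finset.sum_coe_sort F (fun α => δB α)]
    simp [hδB, hBF]
  have hδmean : ∀ i, ∑ a : F, δB a.1 * dvec B a.1 i = 0 := by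
    intro i
    rw [Finset.sum_coe_sort F (fun α => δB α * dvec B α i)]
    simp [hδB, hBF, dvec_self]
  have hxL : ∀ v ∈ L, ∑ a : F, x a * (v a : ℝ) = 0 := by
    intro v hv
    rcases List.mem_cons.1 hv with rfl | hv
    · simp only [Int.cast_one, mul_one, hx, Finset.sum_sub_distrib, hδsum]
      rw [Finset.sum_coe_sort F μ, hμsum, sub_self]
    · rw [List.mem_ofFn] at hv
      obtain ⟨i, rfl⟩ := hv
      have h1 : ∀ a : F, x a * ((((a.1 i : ℕ) : ℤ) - ((B i : ℕ) : ℤ) : ℤ) : ℝ) = μ a.1 * dvec B a.1 i - δB a.1 * dvec B a.1 i := by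
        intro a; simp only [hx, dvec]; push_cast; ring
      simp only [h1, Finset.sum_sub_distrib, hδmean, sub_zero]
      rw [Finset.sum_coe_sort F (fun α => μ α * dvec B α i), hμmean i]
  -- integer approximation `K/D` of `x`
  obtain ⟨D, K, hD, hKL, hKx⟩ := exists_int_near_of_integer_system L x hxL hεpos
  have hK1 : ∑ a : F, K a = 0 := by simpa using hKL (fun _ => (1 : ℤ)) (by simp [hL])
  have hKmean : ∀ i, ∑ a : F, K a * (((a.1 i : ℕ) : ℤ) - ((B i : ℕ) : ℤ)) = 0 := fun i =>
    hKL _ (List.mem_cons_of_mem _ (List.mem_ofFn.2 ⟨i, rfl⟩))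
  -- the integer measure `k = K + D δ_B ≥ 0` on `F` (extended by `0`)
  have hKpos : ∀ a : F, 0 < (K a : ℝ) + D * δB a.1 := by
    intro a
    have h1 := hKx a
    have hD' : (0 : ℝ) < D := by exact_mod_cast hD
    rw [abs_lt] at h1
    have h2 : μ a.1 - δB a.1 - ε < (K a : ℝ) / D := by simp only [hx] at h1; linarith [h1.2]
    have h3 : 0 ≤ μ a.1 - ε := by linarith [hεμ a.1 a.2]
    have h4 : (K a : ℝ) / D * D = K a := div_mul_cancel₀ _ hD'.ne'
    nlinarith
  have hKposZ : ∀ a : F, 0 < K a + D * (if a.1 = B then 1 else 0 : ℤ) := by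
    intro a
    have h := hKpos a
    simp only [hδB] at h
    have : ((K a + D * (if a.1 = B then 1 else 0 : ℤ) : ℤ) : ℝ) = (K a : ℝ) + D * (if a.1 = B then (1 : ℝ) else 0) := by
      push_cast; split_ifs <;> simp
    exact_mod_cast (this ▸ h : (0 : ℝ) < ((K a + D * (if a.1 = B then 1 else 0 : ℤ) : ℤ) : ℝ))
  set k : (Fin d →₀ ℕ) → ℕ := fun α => if h : α ∈ F then (K ⟨α, h⟩ + D * (if α = B then 1 else 0 : ℤ)).toNat else 0
    with hk_def
  have hk_cast : ∀ a : F, ((k a.1 : ℕ) : ℤ) = K a + D * (if a.1 = B then 1 else 0 : ℤ) := by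
    intro a
    simp only [hk_def, a.2, dif_pos]
    exact Int.toNat_of_nonneg (hKposZ a).le
  have hk_off : ∀ α, α ∉ F → k α = 0 := fun α hα => by simp [hk_def, hα]
  have hkS : ∀ α, k α ≠ 0 → α ∈ S := fun α hα => by
    by_contra hαS
    exact hα (hk_off α fun hαF => hαS (hFS hαF))
  -- `Σ k = D`
  have hksum : ∑ α ∈ S, k α = D := by
    have h1 : ∑ α ∈ S, k α = ∑ α ∈ F, k α :=
      (Finset.sum_subset hFS fun α _ hαF => hk_off α hαF).symm
    rw [h1]
    have h2 : ((∑ α ∈ F, k α : ℕ) : ℤ) = D := by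
      rw [Nat.cast_sum, ← Finset.sum_coe_sort F (fun α => ((k α : ℕ) : ℤ))]
      simp only [hk_cast, Finset.sum_add_distrib, hK1, zero_add, ← Finset.mul_sum]
      rw [Finset.sum_coe_sort F (fun α => (if α = B then (1 : ℤ) else 0))]
      simp [hBF]
    exact_mod_cast h2
  -- `Σ k_α α = D • B`
  have hkmean : typeExp S k = D • B := by
    ext i
    rw [typeExp_apply, Finsupp.smul_apply, smul_eq_mul]
    have h1 : ∑ α ∈ S, k α * α i = ∑ α ∈ F, k α * α i :=
      (Finset.sum_subset hFS fun α _ hαF => by rw [hk_off α hαF, zero_mul]).symm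
    rw [h1]
    have h2 : ((∑ α ∈ F, k α * α i : ℕ) : ℤ) = D * B i := by
      rw [Nat.cast_sum, ← Finset.sum_coe_sort F (fun α => ((k α * α i : ℕ) : ℤ))]
      have h3 : ∀ a : F, ((k a.1 * a.1 i : ℕ) : ℤ) =
          K a * (((a.1 i : ℕ) : ℤ) - ((B i : ℕ) : ℤ)) + K a * B i + D * ((if a.1 = B then (1 : ℤ) else 0) * a.1 i) := by
        intro a; push_cast; rw [hk_cast a]; ring
      simp only [h3, Finset.sum_add_distrib, hKmean i, zero_add, ← Finset.sum_mul, hK1, zero_mul, ← Finset.mul_sum]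
      rw [Finset.sum_coe_sort F (fun α => (if α = B then (1 : ℤ) else 0) * (α i : ℤ))]
      simp [hBF]
    exact_mod_cast h2
  -- the method of types
  have hlow := eventually_le_log_coeff_div hc hB k hkS hD hksum hkmean (half_pos hη)
  -- compare the entropy functionals: `k/D` is `ε`-close to `μ` on `F`
  have hclose : ∀ α ∈ F, |(k α : ℝ) / D - μ α| < ε := by
    intro α hα
    have hD' : (0 : ℝ) < D := by exact_mod_cast hD
    have h1 : ((k α : ℕ) : ℝ) = (K ⟨α, hα⟩ : ℝ) + D * δB α := by
      have := hk_cast ⟨α, hα⟩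
      simp only at this
      have h' : ((k α : ℕ) : ℝ) = (((k α : ℕ) : ℤ) : ℝ) := by push_cast; rfl
      rw [h', this]; push_cast; simp [hδB]
    have h2 : (k α : ℝ) / D - μ α = -(x ⟨α, hα⟩ - (K ⟨α, hα⟩ : ℝ) / D) := by
      rw [h1, hx]; field_simp; ring
    rw [h2, abs_neg]
    exact hKx ⟨α, hα⟩
  have hent_eq : entropyFun S c (fun α => (k α : ℝ) / D) = entropyFun F c (fun α => (k α : ℝ) / D) := by
    unfold entropyFun
    refine (Finset.sum_subset hFS fun α _ hαF => ?_).symm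
    simp [hk_off α hαF]
  have hent_near : |entropyFun F c (fun α => (k α : ℝ) / D) - entropyFun F c μ| < η / 2 :=
    hnear _ fun α hα => lt_of_lt_of_le (hclose α hα) (min_le_left _ _)
  filter_upwards [hlow] with n hn
  rw [hent_eq] at hn
  rw [abs_lt] at hent_near
  rw [← hμent]
  linarith [hent_near.1]

/-- **THE LIMIT**: `(1/n) log [x^{nB}] (poly S c)ⁿ → log min_u Σ_{α ∈ face S B} c_α e^{(α−B)·u}`
(`c > 0` on `S`, `B ∈ S`, `u₀` any minimiser of the tilt on the face). -/
theorem tendsto_log_coeff_div {S : Finset (Fin d →₀ ℕ)} {c : (Fin d →₀ ℕ) → ℝ} (hc : ∀ α ∈ S, 0 < c α)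
    {B : Fin d →₀ ℕ} (hB : B ∈ S) {u₀ : Fin d → ℝ} (hmin : ∀ u, tilt (face S B) c B u₀ ≤ tilt (face S B) c B u) :
    Tendsto (fun n : ℕ => Real.log (coeff (n • B) (poly S c ^ n)) / n) atTop
      (𝓝 (Real.log (tilt (face S B) c B u₀))) := by
  rw [tendsto_order]
  constructor
  · intro a ha
    have hη : 0 < Real.log (tilt (face S B) c B u₀) - a := by linarith
    filter_upwards [eventually_ge_of_min hc hB hmin (half_pos hη)] with n hn
    linarith
  · intro a ha
    filter_upwards [eventually_gt_atTop 0] with n hn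
    exact lt_of_le_of_lt (log_coeff_div_le hc hB u₀ hn.ne') ha

end CoeffAsymp

end Summit.KontsevichZagierPeriods.Zeta5Search.Families.Cellular
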